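import Mathlib.Analysis.InnerProductSpace.GramSchmidtOrtho
import HarnessLib

/-!
# Gram–Schmidt vectors as orthogonal projections; the prefix property

For a family `f : ι → E` in a finite-dimensional inner product space (`ι` a locally finite
well-order with bottom):

* `gramSchmidt_eq_starProjection`: the `j`-th Gram–Schmidt vector is the orthogonal projection of
  `f j` onto the orthogonal complement of `span {f i | i < j}`;
* `gramSchmidt_congr`: hence `gramSchmidt f j` only depends on `f i` for `i ≤ j`;
* `gramSchmidt_comp_castLE`: and for `f : Fin m → E`, `n ≤ m`, the Gram–Schmidt vectors of the
  first `n` vectors are the first `n` Gram–Schmidt vectors (`gramSchmidt (f ∘ castLE) j =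
  gramSchmidt f (castLE j)`), with the same statements for `gramSchmidtNormed`.

These are the structural facts about Gram–Schmidt used by column-by-column (hybrid) arguments
for Haar-distributed unitary matrices.
-/

open InnerProductSpace Submodule Finset

namespace Literature.Probability.RandomMatrix

variable {𝕜 : Type*} [RCLike 𝕜] {E : Type*} [NormedAddCommGroup E] [InnerProductSpace 𝕜 E]
  [FiniteDimensional 𝕜 E]
variable {ι : Type*} [LinearOrder ι] [LocallyFiniteOrderBot ι] [WellFoundedLT ι]

/-- **Gram–Schmidt as a projection**: `gramSchmidt f j` is the orthogonal projection of `f j`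
onto `(span {f i | i < j})ᗮ`. [folklore] -/
theorem gramSchmidt_eq_starProjection (f : ι → E) (j : ι) :
    gramSchmidt 𝕜 f j = (span 𝕜 (f '' Set.Iio j))ᗮ.starProjection (f j) := by
  symm
  have hspan : span 𝕜 (f '' Set.Iio j) = span 𝕜 (gramSchmidt 𝕜 f '' Set.Iio j) :=
    (span_gramSchmidt_Iio 𝕜 f j).symm
  refine eq_starProjection_of_mem_orthogonal ?_ ?_
  · -- `gramSchmidt f j ⟂ span {f i | i < j}`
    rw [hspan, mem_orthogonal]
    have hle : span 𝕜 (gramSchmidt 𝕜 f '' Set.Iio j) ≤ (𝕜 ∙ gramSchmidt 𝕜 f j)ᗮ := by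
      refine span_le.2 ?_
      rintro _ ⟨i, hi, rfl⟩
      rw [SetLike.mem_coe, mem_orthogonal_singleton_iff_inner_right]
      exact gramSchmidt_orthogonal 𝕜 f (ne_of_lt (Set.mem_Iio.1 hi)).symm
    intro u hu
    have := (mem_orthogonal_singleton_iff_inner_right.1 (hle hu))
    exact inner_eq_zero_symm.1 this
  · -- `f j - gramSchmidt f j ∈ span {f i | i < j} = (span …)ᗮᗮ`
    rw [orthogonal_orthogonal, gramSchmidt_def 𝕜 f j, sub_sub_cancel, hspan]
    refine Submodule.sum_mem _ fun i hi => ?_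
    have h1 : (𝕜 ∙ gramSchmidt 𝕜 f i).starProjection (f j) ∈ 𝕜 ∙ gramSchmidt 𝕜 f i :=
      starProjection_apply_mem _ _
    refine (span_mono ?_) h1
    exact Set.singleton_subset_iff.2 (Set.mem_image_of_mem _ (Finset.mem_Iio.1 hi))

/-- **Locality of Gram–Schmidt**: `gramSchmidt f j` only depends on `f i`, `i ≤ j`. [folklore] -/
theorem gramSchmidt_congr {f f' : ι → E} {j : ι} (h : ∀ i ≤ j, f i = f' i) :
    gramSchmidt 𝕜 f j = gramSchmidt 𝕜 f' j := by
  rw [gramSchmidt_eq_starProjection, gramSchmidt_eq_starProjection, h j le_rfl]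
  have : f '' Set.Iio j = f' '' Set.Iio j :=
    Set.image_congr fun i hi => h i (le_of_lt (Set.mem_Iio.1 hi))
  rw [this]

/-- Locality of the normalised Gram–Schmidt vectors. [folklore] -/
theorem gramSchmidtNormed_congr {f f' : ι → E} {j : ι} (h : ∀ i ≤ j, f i = f' i) :
    gramSchmidtNormed 𝕜 f j = gramSchmidtNormed 𝕜 f' j := by
  rw [gramSchmidtNormed, gramSchmidtNormed, gramSchmidt_congr h]

/-- The initial segments match under `Fin.castLE`: `castLE '' {i | i < j} = {i' | i' < castLE j}`.
[folklore] -/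
theorem image_castLE_Iio {n m : ℕ} (hle : n ≤ m) (j : Fin n) :
    Fin.castLE hle '' Set.Iio j = Set.Iio (Fin.castLE hle j) := by
  ext i'
  simp only [Set.mem_image, Set.mem_Iio]
  constructor
  · rintro ⟨i, hi, rfl⟩
    exact hi
  · intro hi
    have hi' : (i' : ℕ) < n := lt_of_lt_of_le (show (i' : ℕ) < (j : ℕ) from hi) j.2.le
    refine ⟨⟨i', hi'⟩, ?_, Fin.ext rfl⟩
    exact hi

/-- **Prefix property of Gram–Schmidt**: the Gram–Schmidt vectors of the first `n` vectors of
`f : Fin m → E` are the first `n` Gram–Schmidt vectors of `f`. [folklore] -/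
theorem gramSchmidt_comp_castLE {n m : ℕ} (hle : n ≤ m) (f : Fin m → E) (j : Fin n) :
    gramSchmidt 𝕜 (f ∘ Fin.castLE hle) j = gramSchmidt 𝕜 f (Fin.castLE hle j) := by
  rw [gramSchmidt_eq_starProjection, gramSchmidt_eq_starProjection, Set.image_comp,
    image_castLE_Iio hle j]
  rfl

/-- Prefix property for the normalised vectors. [folklore] -/
theorem gramSchmidtNormed_comp_castLE {n m : ℕ} (hle : n ≤ m) (f : Fin m → E) (j : Fin n) :
    gramSchmidtNormed 𝕜 (f ∘ Fin.castLE hle) j = gramSchmidtNormed 𝕜 f (Fin.castLE hle j) := by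
  rw [gramSchmidtNormed, gramSchmidtNormed, gramSchmidt_comp_castLE]

/-- The normalised Gram–Schmidt vector is `‖·‖⁻¹` times the projection residual. [folklore] -/
theorem gramSchmidtNormed_eq_smul_starProjection (f : ι → E) (j : ι) :
    gramSchmidtNormed 𝕜 f j =
      ((‖(span 𝕜 (f '' Set.Iio j))ᗮ.starProjection (f j)‖⁻¹ : ℝ) : 𝕜) •
        (span 𝕜 (f '' Set.Iio j))ᗮ.starProjection (f j) := by
  rw [gramSchmidtNormed, gramSchmidt_eq_starProjection]
  norm_cast

omit [FiniteDimensional 𝕜 E] in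
/-- Gram–Schmidt vectors have norm at most `1` after normalisation (`1` or `0`). [folklore] -/
theorem norm_gramSchmidtNormed_le_one (f : ι → E) (j : ι) : ‖gramSchmidtNormed 𝕜 f j‖ ≤ 1 := by
  by_cases h : gramSchmidtNormed 𝕜 f j = 0
  · rw [h, norm_zero]; exact zero_le_one
  · rw [gramSchmidtNormed_unit_length' h]

end Literature.Probability.RandomMatrix
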